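import Summits.QuantumFields.YangMills.Theorems.BalabanUVNodesN11OldBranchIntegrableOfDominated
import Literature.MathematicalPhysics.QuantumFieldTheory.GaussianToolkit

/-!
# DAG node N11 — THE K0b A-FIBRE DOMINATION ROW OF THE NO-EXPANSION 𝐓-STEP FROM COERCIVITY OF THE RESIDUAL's `quad`:
# at a GENERIC `θ : Stage13HParams`, for EVERY branch `S`, EVERY generation `j`, EVERY history, the binder
# «∃ ŵ measurable, ∫⁻ ŵ < ⊤, χ_A·e^{−½quad} ≤ ŵ(A|_{sA})» of `…N11OldBranchIntegrableOfDominated` holds as soon as [I]'s form value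
# `quad_j(Λ_{j+1})` dominates `c·Σ_{b ∈ sA_j} ‖A_j(b)‖²` (`c > 0`) — with the explicit Gaussian majorant `ŵ(a) = Π_b e^{−c‖a b‖²∕2}`

HEADER — WORK-UNIT METADATA.  Cell `pub-ymgap`, YM-PLAN Track A (HUMAN RULING D-0062 ∕ D-0149 work-bound push), WIDTH SEAT `pub-ymgap-dag-n11-w4` (g0) on NODE n11
[B14]; route `BalabanUVNodes` rev 25, item K1⁷ `StabilityBAtRecordR13SepCoPH` = stmt-QuantumFields-20542 (helper, `--kind proof --supports 20542 --as helper`,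
count-neutral).  W-SEAT-START-LIST §n11 item 4 («successor pieces of doors (d2)∕(d3)»): dag-n11-d g10's door (d3) left the residue {A-FIBRE DOMINATION (K0b's
VALUE of `Zh.quad`), operand measurable, operand bounded} (`…N11OldBranchIntegrableOfDominated` = p580601, §2 ★★ `integrable_oldBranch_of_dominated`, §4 ★★★
`exists_local_witness_clause_succ_rePinH_of_sLaw₁₃CoPH_of_dominated`) and LOCATED (bus l.23933): *«FILE 9's domination row is exactly what that value has to satisfy
(`χ_A·e^{−½quad} ≤ ŵ(A|sA)`, `∫ŵ < ∞`)»*.  THIS FILE makes that sentence a kernel theorem: the domination row FOLLOWS from ONE pointwise row on the VALUE of the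
residual's `quad` — COERCIVITY on the integrated fluctuation variables, the shape of [I]'s positivity of the fluctuation form `𝒬_j` ([III] (2.21) p. 258:
`exp[−½⟨A_j, C*Δ^{(j)}CA_j⟩ + ½⟨…⟩]`, a normalisable Gaussian) — for EVERY branch `S` (large-fluctuation cubes or not: `χ_A ≤ 1`), with NO covering geometry.
[III] = [Balaban1988Convergent], [I] = [Balaban1987RG1].

WHAT THIS FILE PROVES (0 `sorry`, 0 `def`; standard axioms).
§1 (generic, finite products of Euclidean fibres `ι → EuclideanSpace ℝ κ` under product Lebesgue measure): `measurable_gaussFactor`, `measurable_gaussMajorant`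
(`a ↦ Π_i e^{−c‖a i‖²∕2}` as an `ℝ≥0∞`-valued function), `lintegral_gaussFactor_eq` (`∫ e^{−c‖v‖²∕2} dv = (√c)^{−|κ|}·(2π)^{|κ|∕2}`, scaling + the tree's
`GaussianToolkit.lintegral_exp_neg_norm_sq_div_two`), `lintegral_gaussFactor_ne_top`, `lintegral_gaussMajorant_eq` (Tonelli, the tree's
`GaussianToolkit.lintegral_fintype_prod_eq_prod`), ★ `lintegral_gaussMajorant_ne_top`, `exp_neg_half_le_gaussMajorant` (`e^{−½q} ≤ Π_b e^{−c‖A b‖²∕2}` when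
`c·Σ_b ‖A b‖² ≤ q`).
§2 (generic 12a″ weights `tkWeightsOfRecordP … Z` over ANY residual `Z`): ★★ `afibre_dominated_of_coercive` — coercivity of `Z.quad j Λ'` on the A-fibre
`sA = bondsIn j Y` ⇒ the domination row of p580601 for `w_j(Λ', Y, S)` and EVERY `S` (12a `chiAW_le_one`, `chiAW_nonneg`); the same for 12a's weights with
the regularity factor, `afibre_dominated_of_coercive_tkWeightsOfRecord`; A6 exhibit `coercive_model` (the row is inhabited, jointly with `TkResidualW.Laws`, by the
model residual `quad_j := Σ_b ‖A_j(b)‖²` — NOT print's `𝒬_j`).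
§3 (the v1.7 `CoPH` record, GENERIC `θ`): ★★ `afibre_rows_of_coercive` — the per-branch ∕ per-generation row of p580601 §4 at the history's weights
`WtOfRecord₁₃H θ p s′` from ONE coercivity row on `(θ.zhAt p s′).quad j (Λ_{j+1}(init s′))`; `afibre_rows_adm_of_coercive` (quantified over the admissible old
branches — the binder `hW` verbatim).
§4 ★★★ `integrable_oldBranch_of_coercive` — p580601 §2 `integrable_oldBranch_of_dominated` with its binders `ŵ hŵm Cw hCw hdom` DISCHARGED: the old branch of
record is `dU_k`-integrable from {residual laws + unity + measurability of `ζ0`∕`quad`, COERCIVITY of `quad`, operand measurable + bounded}.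
§5 LOCATED, certifying dag-n11-d's l.23933 sentence in the kernel (`2 ≤ N`): at the certificate `rePinH θ` (`quad ≡ 0`) the coercivity row holds at
generation `j` IFF the A-fibre is a point, `bondsIn j Y = ∅` (`coercive_rePinH_iff_bondsIn_eq_empty`) — so off the all-large diagonal the re-pinned certificate
cannot serve and the Gaussian VALUE of `Zh.quad` (node00-def-K0b, [I]'s `𝒬_j`) is exactly what the 𝐓-step asks for.

HONEST FRAMING.  Helper lane of K1⁷; measure-theoretic bookkeeping over accepted tree objects; [I]'s positivity of `𝒬_j` is a DISPLAYED row (hypothesis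
`hcoer`), NOT asserted; no law of record is edited or posited; no binder quantifies over all term families.  DISJOINT from dag-n11-w1's item (the same row at the
certificate `rePinH θ` on the ALL-SMALL branch via the covering fact) and from dag-n11-d's INTENT-10 (the generic-θ specification; this file supplies one of its
rows from a smaller one).  N11 NOT discharged; K1⁷ NOT closed; counts unmoved (typed 28∕28 · discharged 5∕27).  One finite four-torus programme at fixed
`ε = L^{−K}`; R4 closes only the conditional finite-𝕋⁴ rung `BalabanLadder.UV` — NOT ℝ⁴, NOT OS, NOT a mass gap, NOT Clay.  No `sorry`, `axiom`, `def`,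
`instance`, `notation`.
Sources (SHAPE only): [III] (2.18) p.257, (2.20)–(2.22) p.258, (3.16)–(3.21) pp.268–269, (3.23)–(3.24) p.270; [I] (1.4)–(1.5) pp.260–261, (2.11) p.267 (the Gaussian measure of the fluctuation form `⟨B′, Δ^{(k)}B′⟩`; its positivity is NOT an equation of [I] — it is
cited for the SHAPE of the displayed row only; v1.0.1: cite tag corrected per ref-M READ-15 LOCATED-1).
-/

noncomputable section

open MeasureTheory
open scoped BigOperators ENNReal NNReal

namespace Summit.QuantumFields.YangMills.Theorems.BalabanUVNodesN11AFibreDominationOfCoercive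

open Literature.MathematicalPhysics.QuantumFieldTheory (GaussianToolkit.lintegral_fintype_prod_eq_prod GaussianToolkit.lintegral_comp_smul
  GaussianToolkit.lintegral_exp_neg_norm_sq_div_two)
open Literature.MathematicalPhysics.QuantumFieldTheory.Balaban1983to89 T4Continuum Node00 Node00.Tk
open B15DeterminingSets (MSField)
open B10Eq42TorusConstraint (bondsIn)
open BalabanUVNodesN11OldBranchIntegrableOfDominated (integrable_oldBranch_of_dominated)
open BalabanUVNodesN11RePinnedParamDefs

/-! ## §1  The Gaussian majorant on a finite product of Euclidean fibres -/

section Gauss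

variable {ι : Type*} [Fintype ι] {κ : Type*} [Fintype κ]

/-- One Gaussian factor `v ↦ e^{−c‖v‖²∕2}` (as an `ℝ≥0∞`-valued function of a Euclidean vector) is measurable. [folklore] -/
theorem measurable_gaussFactor (c : ℝ) :
    Measurable fun v : EuclideanSpace ℝ κ => ENNReal.ofReal (Real.exp (-(c * ‖v‖ ^ 2) / 2)) :=
  (Real.measurable_exp.comp ((measurable_const.mul (measurable_norm.pow_const 2)).neg.div_const 2)).ennreal_ofReal

/-- **THE GAUSSIAN MAJORANT** `a ↦ Π_i e^{−c‖a i‖²∕2}` on a finite product of Euclidean fibres is measurable. [folklore] -/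
theorem measurable_gaussMajorant (c : ℝ) :
    Measurable fun a : ι → EuclideanSpace ℝ κ => ∏ i, ENNReal.ofReal (Real.exp (-(c * ‖a i‖ ^ 2) / 2)) :=
  Finset.measurable_prod _ fun i _ => (measurable_gaussFactor c).comp (measurable_pi_apply i)

/-- **ONE FIBRE's GAUSSIAN MASS**: `∫ e^{−c‖v‖²∕2} dv = |(√c)^{dim}|⁻¹ · (2π)^{dim∕2}` on `EuclideanSpace ℝ κ` (`c > 0`; scaling `v ↦ √c·v` and the tree's
`GaussianToolkit.lintegral_exp_neg_norm_sq_div_two`). [folklore] -/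
theorem lintegral_gaussFactor_eq {c : ℝ} (hc : 0 < c) :
    ∫⁻ v : EuclideanSpace ℝ κ, ENNReal.ofReal (Real.exp (-(c * ‖v‖ ^ 2) / 2)) =
      ENNReal.ofReal |(Real.sqrt c ^ Module.finrank ℝ (EuclideanSpace ℝ κ))⁻¹| * ENNReal.ofReal (Real.sqrt (2 * Real.pi) ^ Fintype.card κ) := by
  have hsc : 0 < Real.sqrt c := Real.sqrt_pos.2 hc
  have h1 : ∀ v : EuclideanSpace ℝ κ, -(c * ‖v‖ ^ 2) / 2 = -‖Real.sqrt c • v‖ ^ 2 / 2 := by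
    intro v
    rw [norm_smul, mul_pow, Real.norm_eq_abs, abs_of_pos hsc, Real.sq_sqrt hc.le]
  calc ∫⁻ v : EuclideanSpace ℝ κ, ENNReal.ofReal (Real.exp (-(c * ‖v‖ ^ 2) / 2))
      = ∫⁻ v : EuclideanSpace ℝ κ, ENNReal.ofReal (Real.exp (-‖Real.sqrt c • v‖ ^ 2 / 2)) := by simp_rw [h1]
    _ = ENNReal.ofReal |(Real.sqrt c ^ Module.finrank ℝ (EuclideanSpace ℝ κ))⁻¹| *
          ∫⁻ y : EuclideanSpace ℝ κ, ENNReal.ofReal (Real.exp (-‖y‖ ^ 2 / 2)) :=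
        GaussianToolkit.lintegral_comp_smul volume (fun y : EuclideanSpace ℝ κ => ENNReal.ofReal (Real.exp (-‖y‖ ^ 2 / 2))) hsc.ne'
    _ = _ := by rw [GaussianToolkit.lintegral_exp_neg_norm_sq_div_two]

/-- … in particular it is finite. [folklore] -/
theorem lintegral_gaussFactor_ne_top {c : ℝ} (hc : 0 < c) :
    (∫⁻ v : EuclideanSpace ℝ κ, ENNReal.ofReal (Real.exp (-(c * ‖v‖ ^ 2) / 2))) ≠ ⊤ := by
  rw [lintegral_gaussFactor_eq hc]
  exact ENNReal.mul_ne_top ENNReal.ofReal_ne_top ENNReal.ofReal_ne_top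

/-- **TONELLI**: the product-Lebesgue mass of the Gaussian majorant is the product of the one-fibre masses (the tree's
`GaussianToolkit.lintegral_fintype_prod_eq_prod`). [folklore] -/
theorem lintegral_gaussMajorant_eq (c : ℝ) :
    ∫⁻ a, ∏ i, ENNReal.ofReal (Real.exp (-(c * ‖a i‖ ^ 2) / 2)) ∂(Measure.pi fun _ : ι => (volume : Measure (EuclideanSpace ℝ κ))) =
      ∏ _i : ι, ∫⁻ v : EuclideanSpace ℝ κ, ENNReal.ofReal (Real.exp (-(c * ‖v‖ ^ 2) / 2)) :=
  GaussianToolkit.lintegral_fintype_prod_eq_prod (fun _ : ι => (volume : Measure (EuclideanSpace ℝ κ)))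
    (f := fun _ v => ENNReal.ofReal (Real.exp (-(c * ‖v‖ ^ 2) / 2))) fun _ => measurable_gaussFactor c

/-- ★ **THE GAUSSIAN MAJORANT HAS FINITE PRODUCT-LEBESGUE MASS** (`c > 0`). [folklore] -/
theorem lintegral_gaussMajorant_ne_top {c : ℝ} (hc : 0 < c) :
    (∫⁻ a, ∏ i, ENNReal.ofReal (Real.exp (-(c * ‖a i‖ ^ 2) / 2)) ∂(Measure.pi fun _ : ι => (volume : Measure (EuclideanSpace ℝ κ)))) ≠ ⊤ := by
  rw [lintegral_gaussMajorant_eq]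
  exact ENNReal.prod_ne_top fun _ _ => lintegral_gaussFactor_ne_top hc

/-- **A COERCIVE EXPONENT IS UNDER THE MAJORANT**: `c·Σ_{b∈s} ‖A b‖² ≤ q` gives `e^{−½q} ≤ Π_{b∈s} e^{−c‖A b‖²∕2}`. [folklore] -/
theorem exp_neg_half_le_gaussMajorant {β E : Type*} [SeminormedAddCommGroup E] (s : Finset β) (A : β → E) {c q : ℝ}
    (h : c * ∑ b ∈ s, ‖A b‖ ^ 2 ≤ q) : Real.exp (-(1 / 2 : ℝ) * q) ≤ ∏ b ∈ s, Real.exp (-(c * ‖A b‖ ^ 2) / 2) := by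
  rw [← Real.exp_sum]
  refine Real.exp_le_exp.2 ?_
  have hs : ∑ b ∈ s, (-(c * ‖A b‖ ^ 2) / 2) = (-(1 / 2 : ℝ) * c) * ∑ b ∈ s, ‖A b‖ ^ 2 := by
    rw [Finset.mul_sum]
    exact Finset.sum_congr rfl fun b _ => by ring
  rw [hs]
  nlinarith

end Gauss

/-! ## §2  ★★ Generic 12a″ weights: coercivity of `quad` on the A-fibre ⇒ the domination row, for EVERY branch `S` -/

section Generic

variable {F : T4Family} {N : ℕ} [NeZero N]
variable (ν : Stage7Numerics) (A₁ : ℝ) (p : B12.RunParams) (g : ℕ → ℝ)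

/-- **★★ THE A-FIBRE DOMINATION ROW FROM COERCIVITY**, generic 12a″ weights over ANY residual `Z`: if [I]'s form value of generation `j` for the small-field
domain `Λ'` dominates `c·Σ_{b ∈ sA} ‖A_j(b)‖²` on the A-fibre `sA = bondsIn j Y` (`c > 0`; a DISPLAYED row — the shape of [I]'s positivity of `𝒬_j`, NOT
asserted), then for EVERY `S` the A-weight `w_j(Λ', Y, S) = χ_A(Y, S)·e^{−½quad}` is dominated by the Gaussian majorant `ŵ(a) = Π_{b∈sA} e^{−c‖a b‖²∕2}`
of the integrated variables — measurable, of finite product-Lebesgue mass (§1) — since `0 ≤ χ_A ≤ 1` (12a).  This is p580601's binder «∃ ŵ, Measurable ŵ ∧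
∫⁻ ŵ ≠ ⊤ ∧ ∀ ω, ofReal (w …) ≤ ŵ (A|_{sA})» VERBATIM. [cite: Balaban1988Convergent, (2.21) p.258, (3.21) p.269, (3.23) p.270; Balaban1987RG1, (2.11) p.267 (shape of the row)] -/
theorem afibre_dominated_of_coercive (Z : TkResidualW F N (FluctV N) p.K) (j : ℕ) (Λ' Y S : Set (Site (F.P p.K) 0)) {c : ℝ} (hc : 0 < c)
    (hcoer : ∀ ω : MultiCfg (F.P p.K) (SU N) (FluctV N),
      c * ∑ b ∈ (Set.toFinite (bondsIn j Y)).toFinset, ‖(ω j).2 b‖ ^ 2 ≤ Z.quad j Λ' ω) :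
    ∃ ŵ : (↥(Set.toFinite (bondsIn j Y)).toFinset → FluctV N) → ℝ≥0∞, Measurable ŵ ∧
      (∫⁻ a, ŵ a ∂(Measure.pi fun _ : ↥(Set.toFinite (bondsIn j Y)).toFinset => (volume : Measure (FluctV N)))) ≠ ⊤ ∧
      ∀ ω : MultiCfg (F.P p.K) (SU N) (FluctV N),
        ENNReal.ofReal ((tkWeightsOfRecordP F N (FluctV N) ν A₁ p g Z).w j Λ' Y S ω) ≤
          ŵ (fun b : ↥(Set.toFinite (bondsIn j Y)).toFinset => (ω j).2 b) := by
  refine ⟨fun a => ∏ b, ENNReal.ofReal (Real.exp (-(c * ‖a b‖ ^ 2) / 2)), measurable_gaussMajorant c,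
    lintegral_gaussMajorant_ne_top hc, fun ω => ?_⟩
  have hχ0 := chiAW_nonneg (F := F) (N := N) (V := FluctV N) (ν := ν) (A₁ := A₁) (p := p) (g := g) j Y S ω
  have hχ1 := chiAW_le_one (F := F) (N := N) (V := FluctV N) (ν := ν) (A₁ := A₁) (p := p) (g := g) j Y S ω
  have he := Real.exp_pos (-(1 / 2 : ℝ) * Z.quad j Λ' ω)
  show ENNReal.ofReal (chiAW F N (FluctV N) ν A₁ p g j Y S ω * Real.exp (-(1 / 2 : ℝ) * Z.quad j Λ' ω)) ≤
    ∏ b : ↥(Set.toFinite (bondsIn j Y)).toFinset, ENNReal.ofReal (Real.exp (-(c * ‖(ω j).2 b‖ ^ 2) / 2))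
  calc ENNReal.ofReal (chiAW F N (FluctV N) ν A₁ p g j Y S ω * Real.exp (-(1 / 2 : ℝ) * Z.quad j Λ' ω))
      ≤ ENNReal.ofReal (Real.exp (-(1 / 2 : ℝ) * Z.quad j Λ' ω)) := ENNReal.ofReal_le_ofReal (mul_le_of_le_one_left he.le hχ1)
    _ ≤ ENNReal.ofReal (∏ b ∈ (Set.toFinite (bondsIn j Y)).toFinset, Real.exp (-(c * ‖(ω j).2 b‖ ^ 2) / 2)) :=
        ENNReal.ofReal_le_ofReal (exp_neg_half_le_gaussMajorant _ (fun b => (ω j).2 b) (hcoer ω))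
    _ = ∏ b ∈ (Set.toFinite (bondsIn j Y)).toFinset, ENNReal.ofReal (Real.exp (-(c * ‖(ω j).2 b‖ ^ 2) / 2)) :=
        ENNReal.ofReal_prod_of_nonneg fun b _ => (Real.exp_pos _).le
    _ = ∏ b : ↥(Set.toFinite (bondsIn j Y)).toFinset, ENNReal.ofReal (Real.exp (-(c * ‖(ω j).2 b‖ ^ 2) / 2)) :=
        (Finset.prod_coe_sort _ _).symm

/-- The same for 12a's weights of record `tkWeightsOfRecord … cR … Z` (regularity factor in `ζ`; the A-side `χ_A·e^{−½quad}` is the SAME function, so §2 applies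
verbatim). [cite: Balaban1988Convergent, (2.21) p.258, (3.21) p.269, (3.23) p.270] -/
theorem afibre_dominated_of_coercive_tkWeightsOfRecord (cR : ℝ) (Z : TkResidualW F N (FluctV N) p.K) (j : ℕ) (Λ' Y S : Set (Site (F.P p.K) 0))
    {c : ℝ} (hc : 0 < c)
    (hcoer : ∀ ω : MultiCfg (F.P p.K) (SU N) (FluctV N),
      c * ∑ b ∈ (Set.toFinite (bondsIn j Y)).toFinset, ‖(ω j).2 b‖ ^ 2 ≤ Z.quad j Λ' ω) :
    ∃ ŵ : (↥(Set.toFinite (bondsIn j Y)).toFinset → FluctV N) → ℝ≥0∞, Measurable ŵ ∧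
      (∫⁻ a, ŵ a ∂(Measure.pi fun _ : ↥(Set.toFinite (bondsIn j Y)).toFinset => (volume : Measure (FluctV N)))) ≠ ⊤ ∧
      ∀ ω : MultiCfg (F.P p.K) (SU N) (FluctV N),
        ENNReal.ofReal ((tkWeightsOfRecord F N (FluctV N) ν A₁ cR p g Z).w j Λ' Y S ω) ≤
          ŵ (fun b : ↥(Set.toFinite (bondsIn j Y)).toFinset => (ω j).2 b) :=
  afibre_dominated_of_coercive ν A₁ p g Z j Λ' Y S hc hcoer

omit [NeZero N] in
/-- **A6 EXHIBIT — THE COERCIVITY ROW IS INHABITED JOINTLY WITH THE RESIDUAL LAW** by the model residual `ζ0 := 1`, `quad_j(Λ') := Σ_{all level-j bonds b}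
‖A_j(b)‖²` (with `c = 1`, on every sub-bond-set; NOT print's `𝒬_j` — a range witness showing §2's hypothesis is satisfiable, so §2–§4 are not vacuous).
[cite: Balaban1988Convergent, (2.21) p.258 (bookkeeping)] -/
theorem coercive_model (K : ℕ) :
    (⟨fun _ _ _ => 1, fun j _ ω => ∑ b : PBond (F.P K) j, ‖(ω j).2 b‖ ^ 2⟩ : TkResidualW F N (FluctV N) K).Laws ∧
      ∀ (j : ℕ) (Λ' : Set (Site (F.P K) 0)) (s : Finset (PBond (F.P K) j)) (ω : MultiCfg (F.P K) (SU N) (FluctV N)),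
        (1 : ℝ) * ∑ b ∈ s, ‖(ω j).2 b‖ ^ 2 ≤
          (⟨fun _ _ _ => 1, fun j _ ω => ∑ b : PBond (F.P K) j, ‖(ω j).2 b‖ ^ 2⟩ : TkResidualW F N (FluctV N) K).quad j Λ' ω := by
  refine ⟨⟨fun _ _ _ => zero_le_one⟩, fun j Λ' s ω => ?_⟩
  rw [one_mul]
  exact Finset.sum_le_sum_of_subset_of_nonneg (Finset.subset_univ s) fun b _ _ => sq_nonneg _

end Generic

/-! ## §3  ★★ At the v1.7 `CoPH` record, GENERIC `θ`: the per-branch ∕ per-generation rows from ONE coercivity row on the history's `quad` -/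

section Record

variable {F : T4Family} {N : ℕ} [NeZero N]
variable (θ : Stage13HParams F N) (p : B12.RunParams)

/-- **★★ THE A-FIBRE DOMINATION ROWS OF p580601 §4 AT A GENERIC `θ`, FROM COERCIVITY**: for the history's weights `WtOfRecord₁₃H θ p s′` (12a″ over the
residual `θ.zhAt p s′` serving `s′`), if at every generation `j` the form value `quad_j(Λ_{j+1}(init s′))` dominates `c_j·Σ_{b ∈ sA_j} ‖A_j(b)‖²` on the
A-fibre `sA_j = bondsIn j (Λᶜ_{j+1} ∩ Ω_{j+1})(init s′)` with `c_j > 0`, then for EVERY branch `S` and EVERY `j` the row «∃ ŵ, Measurable ŵ ∧ ∫⁻ ŵ ≠ ⊤ ∧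
∀ ω, ofReal (w_j …) ≤ ŵ (A|_{sA_j})» holds — the binder `hW S _` of ★★★ `exists_local_witness_clause_succ_rePinH_of_sLaw₁₃CoPH_of_dominated` and of dag-n11-d's
generic-θ specification, verbatim. [cite: Balaban1988Convergent, (2.18) p.257, (2.20)–(2.21) p.258, (3.21) p.269, (3.23) p.270; Balaban1987RG1, (2.11) p.267 (shape of the row)] -/
theorem afibre_rows_of_coercive {k : ℕ} (s : SeqOfRecord F θ.ν θ.τ9.M (gOfRecord₁₃ F N θ.toStage13Params p) p.K (k + 1))
    (hcoer : ∀ j : ℕ, ∃ c : ℝ, 0 < c ∧ ∀ ω : MultiCfg (F.P p.K) (SU N) (FluctV N),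
      c * ∑ b ∈ (Set.toFinite (bondsIn j ((s.init.Λ (j + 1))ᶜ ∩ s.init.Ω (j + 1)))).toFinset, ‖(ω j).2 b‖ ^ 2 ≤
        (θ.zhAt p s).quad j (s.init.Λ (j + 1)) ω)
    (S : ℕ → Set (Site (F.P p.K) 0)) (j : ℕ) :
    ∃ ŵ : (↥(Set.toFinite (bondsIn j ((s.init.Λ (j + 1))ᶜ ∩ s.init.Ω (j + 1)))).toFinset → FluctV N) → ℝ≥0∞, Measurable ŵ ∧
      (∫⁻ a, ŵ a ∂(Measure.pi fun _ : ↥(Set.toFinite (bondsIn j ((s.init.Λ (j + 1))ᶜ ∩ s.init.Ω (j + 1)))).toFinset =>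
        (volume : Measure (FluctV N)))) ≠ ⊤ ∧
      ∀ ω, ENNReal.ofReal ((WtOfRecord₁₃H F N θ p s).w j (s.init.Λ (j + 1)) ((s.init.Λ (j + 1))ᶜ ∩ s.init.Ω (j + 1)) (S (j + 1)) ω) ≤
        ŵ (fun b : ↥(Set.toFinite (bondsIn j ((s.init.Λ (j + 1))ᶜ ∩ s.init.Ω (j + 1)))).toFinset => (ω j).2 b) := by
  obtain ⟨c, hc, h⟩ := hcoer j
  exact afibre_dominated_of_coercive θ.ν θ.A₁ p (gOfRecord₁₃ F N θ.toStage13Params p) (θ.zhAt p s) j _ _ _ hc h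

/-- … the same quantified over the admissible old branches `S ∈ admSOfRecord … k (init s′)` — the shape of the binder `hW` of p580601 §4 and of dag-n11-d's
generic-θ specification, so that a consumer discharges it by `afibre_rows_adm_of_coercive θ p s hcoer`. [cite: Balaban1988Convergent, (2.1) p.254, (2.21) p.258, (3.21) p.269] -/
theorem afibre_rows_adm_of_coercive {k : ℕ} (s : SeqOfRecord F θ.ν θ.τ9.M (gOfRecord₁₃ F N θ.toStage13Params p) p.K (k + 1))
    (hcoer : ∀ j : ℕ, ∃ c : ℝ, 0 < c ∧ ∀ ω : MultiCfg (F.P p.K) (SU N) (FluctV N),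
      c * ∑ b ∈ (Set.toFinite (bondsIn j ((s.init.Λ (j + 1))ᶜ ∩ s.init.Ω (j + 1)))).toFinset, ‖(ω j).2 b‖ ^ 2 ≤
        (θ.zhAt p s).quad j (s.init.Λ (j + 1)) ω) :
    ∀ S ∈ admSOfRecord F θ.ν θ.τ9.M (gOfRecord₁₃ F N θ.toStage13Params p) p.K k s.init, ∀ j : ℕ,
      ∃ ŵ : (↥(Set.toFinite (bondsIn j ((s.init.Λ (j + 1))ᶜ ∩ s.init.Ω (j + 1)))).toFinset → FluctV N) → ℝ≥0∞, Measurable ŵ ∧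
        (∫⁻ a, ŵ a ∂(Measure.pi fun _ : ↥(Set.toFinite (bondsIn j ((s.init.Λ (j + 1))ᶜ ∩ s.init.Ω (j + 1)))).toFinset =>
          (volume : Measure (FluctV N)))) ≠ ⊤ ∧
        ∀ ω, ENNReal.ofReal ((WtOfRecord₁₃H F N θ p s).w j (s.init.Λ (j + 1)) ((s.init.Λ (j + 1))ᶜ ∩ s.init.Ω (j + 1)) (S (j + 1)) ω) ≤
          ŵ (fun b : ↥(Set.toFinite (bondsIn j ((s.init.Λ (j + 1))ᶜ ∩ s.init.Ω (j + 1)))).toFinset => (ω j).2 b) :=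
  fun S _ j => afibre_rows_of_coercive θ p s hcoer S j

/-! ## §4  ★★★ `hIB` for one old branch of record, generic `θ`: the domination binders DISCHARGED by the coercivity row -/

/-- **★★★ THE OLD BRANCH OF RECORD IS `dU_k`-INTEGRABLE FROM COERCIVITY OF THE RESIDUAL's `quad`**, generic `θ : Stage13HParams`, any history `s′` of length
`k+1`, any branch `S`, any operand `Φ` of r11's shape — p580601 §2 ★★ `integrable_oldBranch_of_dominated` with its five domination binders `ŵ hŵm Cw hCw hdom`
REPLACED by the one pointwise row `hcoer`: (i) residual rows — `zhLaws`, `ZhUnity`, measurability of `ζ0_j(Y)`∕`quad_j(Λ′)`; (ii′) COERCIVITY —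
`c_j·Σ_{b∈sA_j} ‖A_j(b)‖² ≤ quad_j(Λ_{j+1})` ([I]'s positivity of `𝒬_j`; displayed); (iii) `Φ` measurable with `0 ≤ Φ ≤ CΦ`.  Then
`U₀ ↦ 𝐓_k(init s′, S)[Φ](base_k U₀)` is integrable for product Haar. [cite: Balaban1988Convergent, (2.18) p.257, (2.20)–(2.21) p.258, (3.16)–(3.21) pp.268–269, (3.23)–(3.24) p.270; Balaban1987RG1, (2.11) p.267 (shape of the row)] -/
theorem integrable_oldBranch_of_coercive
    (hZ : ∀ (p : B12.RunParams) (n : ℕ) (Ω Λ : ℕ → Set (Site (F.P p.K) 0)), (θ.Zh p n Ω Λ).Laws) (hU : θ.ZhUnity F N) {k : ℕ}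
    (s : SeqOfRecord F θ.ν θ.τ9.M (gOfRecord₁₃ F N θ.toStage13Params p) p.K (k + 1)) (S : ℕ → Set (Site (F.P p.K) 0))
    (hζm : ∀ j (Y : Set (Site (F.P p.K) 0)), Measurable ((θ.zhAt p s).ζ0 j Y))
    (hqm : ∀ j (Λ' : Set (Site (F.P p.K) 0)), Measurable ((θ.zhAt p s).quad j Λ'))
    (hcoer : ∀ j : ℕ, ∃ c : ℝ, 0 < c ∧ ∀ ω : MultiCfg (F.P p.K) (SU N) (FluctV N),
      c * ∑ b ∈ (Set.toFinite (bondsIn j ((s.init.Λ (j + 1))ᶜ ∩ s.init.Ω (j + 1)))).toFinset, ‖(ω j).2 b‖ ^ 2 ≤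
        (θ.zhAt p s).quad j (s.init.Λ (j + 1)) ω)
    {Φ : SFluct (F.P p.K) (FluctV N) → MSField (F.P p.K) (SU N) → ℝ}
    (hΦm : Measurable fun ω : MultiCfg (F.P p.K) (SU N) (FluctV N) => Φ (S, fun j => (ω j).2) (fun j => (ω j).1))
    (hΦ0 : ∀ a U, 0 ≤ Φ a U) (CΦ : ℝ) (hΦle : ∀ a U, Φ a U ≤ CΦ) :
    Integrable (fun U₀ : GaugeField (F.P p.K) k (SU N) =>
      tkBranchOfRecord F N (FluctV N) θ.ν θ.τ9.M _ p.K (WtOfRecord₁₃H F N θ p s) s.init S k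
        (fun ω => Φ (S, fun j => (ω j).2) (fun j => (ω j).1)) (baseCfg (V := FluctV N) k U₀)) (fieldMeasure (F.P p.K) k (SU N)) := by
  choose ŵ hŵm hŵfin hdom using afibre_rows_of_coercive θ p s hcoer S
  exact integrable_oldBranch_of_dominated θ p hZ hU s S hζm hqm ŵ hŵm
    (fun j => (∫⁻ a, ŵ j a ∂(Measure.pi fun _ : ↥(Set.toFinite (bondsIn j ((s.init.Λ (j + 1))ᶜ ∩ s.init.Ω (j + 1)))).toFinset =>
      (volume : Measure (FluctV N)))).toNNReal)
    (fun j => le_of_eq (ENNReal.coe_toNNReal (hŵfin j)).symm) hdom hΦm hΦ0 CΦ hΦle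

end Record

/-! ## §5  LOCATED: at the certificate `rePinH θ` the coercivity row singles out the all-large diagonal -/

section RePinned

variable {F : T4Family} {N : ℕ} [NeZero N]
variable (θ : Stage13HParams F N) (p : B12.RunParams)

/-- On an EMPTY A-fibre the coercivity row holds at the certificate trivially (any `c`): the all-large-diagonal case, where p580601 §5 already inhabits both
rows. [cite: Balaban1988Convergent, (2.22) p.258, (3.23) p.270 (bookkeeping)] -/
theorem coercive_rePinH_of_bondsIn_eq_empty {n : ℕ} (s : SeqOfRecord F θ.ν θ.τ9.M (gOfRecord₁₃ F N θ.toStage13Params p) p.K n) (j : ℕ)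
    (Λ' Y : Set (Site (F.P p.K) 0)) (hY : bondsIn j Y = ∅) (c : ℝ) (ω : MultiCfg (F.P p.K) (SU N) (FluctV N)) :
    c * ∑ b ∈ (Set.toFinite (bondsIn j Y)).toFinset, ‖(ω j).2 b‖ ^ 2 ≤ ((rePinH θ).zhAt p s).quad j Λ' ω := by
  have h0 : (Set.toFinite (bondsIn j Y)).toFinset = ∅ := by
    rw [← Finset.coe_eq_empty, Set.Finite.coe_toFinset, hY]
  rw [h0, Finset.sum_empty, mul_zero, zhAt_rePinH_quad]

/-- **★ LOCATED — AT THE CERTIFICATE `rePinH θ` (`quad ≡ 0`) COERCIVITY AT GENERATION `j` FORCES AN EMPTY A-FIBRE** (`2 ≤ N`, so that the fluctuation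
fibre `ℝ^{N²−1}` has a non-zero vector): testing the row at the constant configuration `A_j ≡ v₀ ≠ 0` gives `c·|sA|·‖v₀‖² ≤ 0`.  Hence off the all-large
diagonal the re-pinned certificate cannot carry the 𝐓-step's Gaussian: the VALUE of `Zh.quad` (node00-def-K0b, [I]'s `𝒬_j`) is what the row asks for —
dag-n11-d's LOCATED-QUAD sentence (bus l.23933) in the kernel. [cite: Balaban1988Convergent, (2.21)–(2.22) p.258, (3.23) p.270; Balaban1987RG1, (2.11) p.267 (shape)] -/
theorem bondsIn_eq_empty_of_coercive_rePinH (hN : 2 ≤ N) {n : ℕ}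
    (s : SeqOfRecord F θ.ν θ.τ9.M (gOfRecord₁₃ F N θ.toStage13Params p) p.K n) (j : ℕ) (Λ' Y : Set (Site (F.P p.K) 0)) {c : ℝ} (hc : 0 < c)
    (hcoer : ∀ ω : MultiCfg (F.P p.K) (SU N) (FluctV N),
      c * ∑ b ∈ (Set.toFinite (bondsIn j Y)).toFinset, ‖(ω j).2 b‖ ^ 2 ≤ ((rePinH θ).zhAt p s).quad j Λ' ω) :
    bondsIn j Y = ∅ := by
  by_contra hne
  obtain ⟨b₀, hb₀⟩ := Set.nonempty_iff_ne_empty.mpr hne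
  -- a non-zero fluctuation vector (`N² − 1 ≥ 3` coordinates)
  have hdim : 0 < N ^ 2 - 1 := by
    have : 4 ≤ N ^ 2 := by nlinarith
    omega
  set v₀ : FluctV N := EuclideanSpace.single (⟨0, hdim⟩ : Fin (N ^ 2 - 1)) (1 : ℝ) with hv₀
  have hv₀n : ‖v₀‖ = 1 := by rw [hv₀, PiLp.norm_single, norm_one]
  -- test the row at the constant configuration `A ≡ v₀`, `U ≡ 1`
  have h := hcoer fun _ => (fun _ => 1, fun _ => v₀)
  rw [zhAt_rePinH_quad] at h
  have hb₀' : b₀ ∈ (Set.toFinite (bondsIn j Y)).toFinset := (Set.Finite.mem_toFinset _).mpr hb₀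
  have hpos : 0 < ∑ b ∈ (Set.toFinite (bondsIn j Y)).toFinset, ‖((fun _ => v₀ : PBond (F.P p.K) j → FluctV N)) b‖ ^ 2 := by
    refine Finset.sum_pos' (fun b _ => sq_nonneg _) ⟨b₀, hb₀', ?_⟩
    rw [hv₀n]; norm_num
  have : 0 < c * ∑ b ∈ (Set.toFinite (bondsIn j Y)).toFinset, ‖((fun _ => v₀ : PBond (F.P p.K) j → FluctV N)) b‖ ^ 2 := mul_pos hc hpos
  linarith

/-- **★ … HENCE, AT THE CERTIFICATE, COERCIVITY AT GENERATION `j` ⟺ THE A-FIBRE IS A POINT** (`2 ≤ N`, `c > 0`): the re-pinned parameter serves the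
no-expansion 𝐓-step through §4 exactly on the all-large diagonal (`sA_j = ∅`, p580601 §5), nowhere else. [cite: Balaban1988Convergent, (2.21)–(2.22) p.258, (3.23) p.270] -/
theorem coercive_rePinH_iff_bondsIn_eq_empty (hN : 2 ≤ N) {n : ℕ}
    (s : SeqOfRecord F θ.ν θ.τ9.M (gOfRecord₁₃ F N θ.toStage13Params p) p.K n) (j : ℕ) (Λ' Y : Set (Site (F.P p.K) 0)) {c : ℝ} (hc : 0 < c) :
    (∀ ω : MultiCfg (F.P p.K) (SU N) (FluctV N),
      c * ∑ b ∈ (Set.toFinite (bondsIn j Y)).toFinset, ‖(ω j).2 b‖ ^ 2 ≤ ((rePinH θ).zhAt p s).quad j Λ' ω) ↔ bondsIn j Y = ∅ :=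
  ⟨bondsIn_eq_empty_of_coercive_rePinH θ p hN s j Λ' Y hc, fun hY ω => coercive_rePinH_of_bondsIn_eq_empty θ p s j Λ' Y hY c ω⟩

end RePinned

end Summit.QuantumFields.YangMills.Theorems.BalabanUVNodesN11AFibreDominationOfCoercive

end
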